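import Summits.NavierStokesRegularity.NavierStokesRegularity.Theorems.SelfMixingDichotomyCoherentScaleExclusionRobustSwirlCoherence
import Summits.NavierStokesRegularity.NavierStokesRegularity.Theorems.SelfMixingDichotomyCoherentScaleExclusionMixDriftStabilityLocal
import Summits.NavierStokesRegularity.NavierStokesRegularity.Theorems.SelfMixingDichotomyCoherentScaleExclusionHeatGaussianTail
import HarnessLib

/-!
# Route SelfMixingDichotomy — crux `CoherentScaleExclusion` (S2, stmt-NavierStokesRegularity-1423), line `registered`,
# lead c3: LOCALISED robust swirl coherence (the finite-energy form)

Support file (`--supports stmt-NavierStokesRegularity-1423`; registered sub-goal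
`stub_notDissipatesAtScale_of_locallyNear_sphereTangential`).

`stub_notDissipatesAtScale_of_near_sphereTangential` (file `…RobustSwirlCoherence`) needs the drift `u` to be GLOBALLY
`L²`-close to a sphere-tangential `v` — never the case for a finite-energy Navier–Stokes velocity, whose radial
component far from the point carries energy `≫ c₀ r`. THIS FILE localises the hypothesis to the ball `B(0, R r)`: outside,
the difference `u − v` is only bounded in `L²` by an arbitrary `E` (e.g. four times the energies), and the Gaussian
tail of the heat evolution of the bump (`stub_heatBlob_gaussian_upper`: `θ_heat ≤ e^{1/4} e^{−‖x‖²/(4(t−a+r²))} ≤ e^{1/4−R²/6}`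
off `B(0,Rr)` on the window) absorbs it in the localised drift-stability estimate `stub_mixClass_driftStability_local`
as soon as `e^{1/2 − R²/3} E ≤ c₀ r`, a radius `R ≍ √(3 log(E/(c₀ r)))` logarithmic in the scale.

Reading for the crux: for `δ ≤ δ₂` the coherence hypothesis `¬ MIX(r, δ)` of S2 / stub B holds at every scale `r` at
which the solution's velocity is, on the window `[T − r², T − r²/2]` and the ball `B(x₀, R r)` with
`R ≍ √(log(E₀/r))`, within `√(c₀ r)` in `L∞_t L²_x` (e.g. `≤ ε/r` pointwise with `ε ≍ R^{−3/2}`) of a spherical-shell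
flow about `x₀` — a swirl-dominated core, of any amplitude.
-/

noncomputable section

open Literature.Analysis.FluidPDE MeasureTheory Set Function Metric
open scoped ContDiff InnerProductSpace

-- `Summit = Problem` for this summit; the tree lakefile sets `weak.linter.dupNamespace = false`.
set_option linter.dupNamespace false

namespace Summit.NavierStokesRegularity.NavierStokesRegularity.Theorems

set_option maxHeartbeats 400000 in
/-- **ROBUST-loc — localised robust swirl coherence for finite-energy drifts** (registered sub-goal
`stub_notDissipatesAtScale_of_locallyNear_sphereTangential`, lead c3). There are universal `δ₂, c₀ > 0` (`δ₂ = c/2`,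
`c₀ = c² |B₁| / 128`, `c` the heat bump floor) such that for every `R ≥ 1` and `E`: if `v` is tangential to the spheres
about `0` on the window `S = [T − r², T − r²/2]` (`C¹`, divergence-free, square-integrable slices), `u` is jointly
smooth with bounded derivatives on `S × ℝ³` with divergence-free square-integrable slices, the two drifts are
`L²`-close at the scale-invariant rate ON THE BALL `B(0, R r)` only — `∫_{B(0,Rr)} ‖u(t) − v(t)‖² ≤ c₀ r` — with an
arbitrary bound `∫_{B(0,Rr)ᶜ} ‖u(t) − v(t)‖² ≤ E` outside, and the radius is large enough for the Gaussian tail of the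
heat blob to absorb the far field, `e^{1/2 − R²/3} E ≤ c₀ r` (i.e. `R ≳ √(3 log(E/(c₀ r)))`, logarithmic in the scale),
then `¬ DissipatesAtScale u T 0 r δ` for all `0 ≤ δ ≤ δ₂`. Proof as for `stub_notDissipatesAtScale_of_near_sphereTangential`
with the localised drift stability `stub_mixClass_driftStability_local` (`Mi = 1` by the maximum principle, `Mo = e^{1/4} e^{−R²/6}`
by `stub_heatBlob_gaussian_upper` and `t − a + r² ≤ 3r²/2` on the window). This is the form applicable to Navier–Stokes
velocities (finite energy, never globally close to a toroidal field): coherence at scale `r` follows from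
`ε/r`-closeness to a spherical-shell flow on `B(x₀, R r)`, `R ≍ √(log(E₀/r))`. -/
theorem stub_notDissipatesAtScale_of_locallyNear_sphereTangential :
    ∃ δ₂ c₀ : ℝ, 0 < δ₂ ∧ 0 < c₀ ∧
      ∀ (u v : ℝ → EuclideanSpace ℝ (Fin 3) → EuclideanSpace ℝ (Fin 3)) (T r R E : ℝ), 0 < r → 1 ≤ R →
      (∀ t ∈ Set.Icc (T - r ^ 2) (T - r ^ 2 / 2), ∀ x : EuclideanSpace ℝ (Fin 3), inner ℝ (v t x) x = 0) →
      (∀ t ∈ Set.Icc (T - r ^ 2) (T - r ^ 2 / 2), ContDiff ℝ 1 (v t)) →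
      (∀ t ∈ Set.Icc (T - r ^ 2) (T - r ^ 2 / 2), Literature.Analysis.FluidPDE.VectorCalculus.IsDivFree (v t)) →
      (∀ t ∈ Set.Icc (T - r ^ 2) (T - r ^ 2 / 2), MeasureTheory.MemLp (v t) 2 MeasureTheory.volume) →
      IsSmoothSpaceTimeOn (Set.Icc (T - r ^ 2) (T - r ^ 2 / 2)) u →
      (∀ n : ℕ, ∃ C : ℝ, ∀ t ∈ Set.Icc (T - r ^ 2) (T - r ^ 2 / 2), ∀ x : EuclideanSpace ℝ (Fin 3),
        ‖iteratedFDerivWithin ℝ n (Function.uncurry u)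
          (Set.Icc (T - r ^ 2) (T - r ^ 2 / 2) ×ˢ Set.univ) (t, x)‖ ≤ C) →
      (∀ t ∈ Set.Icc (T - r ^ 2) (T - r ^ 2 / 2), Literature.Analysis.FluidPDE.VectorCalculus.IsDivFree (u t)) →
      (∀ t ∈ Set.Icc (T - r ^ 2) (T - r ^ 2 / 2), MeasureTheory.MemLp (u t) 2 MeasureTheory.volume) →
      (∀ t ∈ Set.Icc (T - r ^ 2) (T - r ^ 2 / 2),
        ∫ x in Metric.ball (0 : EuclideanSpace ℝ (Fin 3)) (R * r), ‖u t x - v t x‖ ^ 2 ≤ c₀ * r) →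
      (∀ t ∈ Set.Icc (T - r ^ 2) (T - r ^ 2 / 2),
        ∫ x in (Metric.ball (0 : EuclideanSpace ℝ (Fin 3)) (R * r))ᶜ, ‖u t x - v t x‖ ^ 2 ≤ E) →
      Real.exp (1 / 2 - R ^ 2 / 3) * E ≤ c₀ * r →
      ∀ δ : ℝ, 0 ≤ δ → δ ≤ δ₂ → ¬ DissipatesAtScale u T 0 r δ := by
  obtain ⟨c, hc, hHF⟩ := stub_heatBumpFloor_allScales
  -- unit-ball volume
  set V₁ : ℝ := (volume : Measure (EuclideanSpace ℝ (Fin 3))).real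
      (Metric.ball (0 : EuclideanSpace ℝ (Fin 3)) 1) with hV₁
  have hV₁0 : 0 < V₁ := by
    rw [hV₁, measureReal_def]
    exact ENNReal.toReal_pos (measure_ball_pos volume _ one_pos).ne' measure_ball_lt_top.ne
  -- constants: `δ₂ = c/2`, `c₀ = c² V₁ / 128`
  refine ⟨c / 2, c ^ 2 * V₁ / 128, by positivity, by positivity, ?_⟩
  intro u v T r R E hr hR hvtan hvC1 hvdiv hvL2 husm hubd hudiv huL2 hin hout hRE δ hδ0 hδ2 hmix
  have hr2 : 0 < r ^ 2 := by positivity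
  have hab : T - r ^ 2 < T - r ^ 2 / 2 := by linarith
  -- the radial bump and its HEAT evolution `θh`
  obtain ⟨θ₀, hθ₀s, hθ₀c, hθ₀0, hθ₀1, hone, hsupp, hrad⟩ := stub_radialBump r hr
  have hz : IsSmoothSpaceTimeOn (Set.Icc (T - r ^ 2) (T - r ^ 2 / 2))
      (fun (_ : ℝ) (_ : EuclideanSpace ℝ (Fin 3)) => (0 : EuclideanSpace ℝ (Fin 3))) :=
    contDiffOn_const
  have hzb : ∀ n : ℕ, ∃ C : ℝ, ∀ t ∈ Set.Icc (T - r ^ 2) (T - r ^ 2 / 2), ∀ x : EuclideanSpace ℝ (Fin 3),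
      ‖iteratedFDerivWithin ℝ n (Function.uncurry
        (fun (_ : ℝ) (_ : EuclideanSpace ℝ (Fin 3)) => (0 : EuclideanSpace ℝ (Fin 3))))
        (Set.Icc (T - r ^ 2) (T - r ^ 2 / 2) ×ˢ Set.univ) (t, x)‖ ≤ C := by
    intro n
    refine ⟨0, fun t _ x => ?_⟩
    have h0 : Function.uncurry (fun (_ : ℝ) (_ : EuclideanSpace ℝ (Fin 3)) =>
        (0 : EuclideanSpace ℝ (Fin 3))) = fun _ => 0 := by
      funext p; rfl
    rw [h0, iteratedFDerivWithin_fun_zero]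
    simp
  obtain ⟨θh, hhsm, hhdec, hhpde0, hha⟩ :=
    stub_advectionDiffusionSchwartz (T - r ^ 2) (T - r ^ 2 / 2) hab _ hz hzb θ₀ hθ₀s hθ₀c
  have hheat : ∀ t ∈ Set.Icc (T - r ^ 2) (T - r ^ 2 / 2), ∀ x : EuclideanSpace ℝ (Fin 3),
      timeDerivWithin (Set.Icc (T - r ^ 2) (T - r ^ 2 / 2)) θh t x = Laplacian.laplacian (θh t) x := by
    intro t ht x
    have h := hhpde0 t ht x
    rwa [inner_zero_left, add_zero] at h
  -- `θh` solves the `v`-equation (tangential drift, radial solution)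
  have hradh : ∀ x y : EuclideanSpace ℝ (Fin 3), ‖x‖ = ‖y‖ → θh (T - r ^ 2) x = θh (T - r ^ 2) y := by
    intro x y hxy; rw [hha]; exact hrad x y hxy
  have hvpde : ∀ t ∈ Set.Icc (T - r ^ 2) (T - r ^ 2 / 2), ∀ x : EuclideanSpace ℝ (Fin 3),
      timeDerivWithin (Set.Icc (T - r ^ 2) (T - r ^ 2 / 2)) θh t x + inner ℝ (v t x) (gradient (θh t) x)
        = Laplacian.laplacian (θh t) x := by
    intro t ht x
    rw [inner_gradient_heat_eq_zero_of_tangential hab hhsm hhdec hheat hradh ht (hvtan t ht x), add_zero]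
    exact hheat t ht x
  -- the `u`-evolution `θu` of the same datum (W2 with the drift `u`)
  obtain ⟨θu, husm', hudec', hupde, hua⟩ :=
    stub_advectionDiffusionSchwartz (T - r ^ 2) (T - r ^ 2 / 2) hab u husm hubd θ₀ hθ₀s hθ₀c
  -- max principle for the heat solution: `|θh| ≤ 1`
  have hM : ∀ t ∈ Set.Icc (T - r ^ 2) (T - r ^ 2 / 2), ∀ x : EuclideanSpace ℝ (Fin 3), |θh t x| ≤ 1 := by
    refine stub_mixClass_abs_le_of_datum (T - r ^ 2) (T - r ^ 2 / 2) hab (fun _ _ => 0) θh 0 1 hhsm hhdec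
      hhpde0 (fun t _ x => by simp) (fun x => ?_)
    rw [hha, abs_le]
    exact ⟨by linarith [hθ₀0 x], hθ₀1 x⟩
  -- Gaussian tail of the heat blob outside `B(0, R r)` on the window: `θh ≤ e^{1/4} e^{-R²/6}`
  have htail : ∀ t ∈ Set.Icc (T - r ^ 2) (T - r ^ 2 / 2),
      ∀ x ∈ (Metric.ball (0 : EuclideanSpace ℝ (Fin 3)) (R * r))ᶜ,
      |θh t x| ≤ Real.exp (1 / 4) * Real.exp (-(R ^ 2) / 6) := by
    intro t ht x hx
    have hpos : ∀ s ∈ Set.Icc (T - r ^ 2) (T - r ^ 2 / 2), ∀ y : EuclideanSpace ℝ (Fin 3), 0 ≤ θh s y :=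
      stub_admissibleMinPrinciple T r (fun _ _ => 0) θh hr hhsm hhdec hhpde0 (fun y => by rw [hha]; exact hθ₀0 y)
    rw [abs_of_nonneg (hpos t ht x)]
    have hup := stub_heatBlob_gaussian_upper (T - r ^ 2) (T - r ^ 2 / 2) hab θh r hr hhsm hhdec hheat
      (fun y => by rw [hha]; exact hθ₀1 y) (by rw [hha]; exact hsupp) t ht x
    refine hup.trans (mul_le_mul_of_nonneg_left (Real.exp_le_exp.2 ?_) (Real.exp_pos _).le)
    -- `-‖x‖²/(4 (t - a + r²)) ≤ -R²/6` as `‖x‖ ≥ R r` and `t - a + r² ≤ 3r²/2`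
    have hxR : R * r ≤ ‖x‖ := by simpa [Metric.mem_ball, dist_zero_right] using hx
    have hs0 : 0 < t - (T - r ^ 2) + r ^ 2 := by linarith [ht.1]
    have hs1 : t - (T - r ^ 2) + r ^ 2 ≤ 3 * r ^ 2 / 2 := by linarith [ht.2]
    rw [div_le_iff₀ (by positivity), neg_div, neg_mul, neg_le_neg_iff]
    have h1 : (R * r) ^ 2 ≤ ‖x‖ ^ 2 := pow_le_pow_left₀ (by positivity) hxR 2
    nlinarith
  -- drift stability, localized: `∫ (θu − θh)(t)² ≤ (1² · c₀ r + (e^{1/4} e^{-R²/6})² · E) · (t − a)`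
  have huC1 : ∀ t ∈ Set.Icc (T - r ^ 2) (T - r ^ 2 / 2), ContDiff ℝ 1 (u t) := fun t ht =>
    (husm.contDiff_slice ht).of_le (by norm_cast)
  have hdat : θu (T - r ^ 2) = θh (T - r ^ 2) := by rw [hua, hha]
  have hstab := stub_mixClass_driftStability_local (T - r ^ 2) (T - r ^ 2 / 2) hab u v θu θh
    (Metric.ball (0 : EuclideanSpace ℝ (Fin 3)) (R * r)) measurableSet_ball husm' hudec' hupde
    hhsm hhdec hvpde huC1 hudiv huL2 hvC1 hvdiv hvL2 hdat 1 (Real.exp (1 / 4) * Real.exp (-(R ^ 2) / 6))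
    (c ^ 2 * V₁ / 128 * r) E zero_le_one (by positivity) (fun t ht x _ => hM t ht x) htail hin hout
    (T - r ^ 2 / 2) ⟨hab.le, le_rfl⟩
  have hWle : ∫ x, (θu (T - r ^ 2 / 2) x - θh (T - r ^ 2 / 2) x) ^ 2 ≤ c ^ 2 * V₁ / 64 * r * (r ^ 2 / 2) := by
    refine hstab.trans ?_
    have hexp : (Real.exp (1 / 4) * Real.exp (-(R ^ 2) / 6)) ^ 2 * E ≤ c ^ 2 * V₁ / 128 * r := by
      have h1 : (Real.exp (1 / 4) * Real.exp (-(R ^ 2) / 6)) ^ 2 = Real.exp (1 / 2 - R ^ 2 / 3) := by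
        rw [← Real.exp_add, ← Real.exp_nat_mul]
        congr 1; push_cast; ring
      rw [h1]; exact hRE
    have hlen : T - r ^ 2 / 2 - (T - r ^ 2) = r ^ 2 / 2 := by ring
    rw [hlen, one_pow, one_mul]
    have hE : 0 ≤ (1 : ℝ) := zero_le_one
    nlinarith [hexp, hr2]
  -- MIX applied to `θu`
  have hsuppu : Function.support (θu (T - r ^ 2)) ⊆ Metric.ball (0 : EuclideanSpace ℝ (Fin 3)) r := by
    rw [hua]; exact hsupp
  have hA : ∫ x, (θu (T - r ^ 2 / 2) x) ^ 2 ≤ δ ^ 2 * ∫ x, (θ₀ x) ^ 2 := by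
    have h := hmix θu husm' hudec' hupde hsuppu
    rwa [hua] at h
  -- heat floor for `θh`
  have hsupph : Function.support (θh (T - r ^ 2)) ⊆ Metric.ball (0 : EuclideanSpace ℝ (Fin 3)) r := by
    rw [hha]; exact hsupp
  have hB : c ^ 2 * ∫ x, (θ₀ x) ^ 2 < ∫ x, (θh (T - r ^ 2 / 2) x) ^ 2 := by
    have h := hHF T r 0 hr θh hhsm hhdec hheat
      (fun x => by rw [hha]; exact hθ₀0 x) (fun x => by rw [hha]; exact hθ₀1 x)
      (fun x hx => by rw [hha]; exact hone x hx) hsupph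
    rwa [hha] at h
  -- mass of the datum from below: `(r/2)³ V₁ ≤ ∫ θ₀²`
  have hint0 : Integrable (fun x => (θ₀ x) ^ 2) := by
    have h := typeIFloor_integrable_sq_slice hhsm hhdec (t := T - r ^ 2) ⟨le_rfl, hab.le⟩
    rwa [hha] at h
  have hX : 1 ^ 2 * ((r / 2) ^ 3 * V₁) ≤ ∫ x, (θ₀ x) ^ 2 :=
    typeIFloor_le_integral_sq_of_floor hr.le zero_le_one hint0 (fun x hx => (hone x hx).symm.le)
  rw [one_pow, one_mul] at hX
  -- the `L²` triangle inequality `√∫θh² ≤ √∫θu² + √∫w²` in squared form via Cauchy–Schwarz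
  set A : ℝ := ∫ x, (θu (T - r ^ 2 / 2) x) ^ 2 with hAdef
  set Bh : ℝ := ∫ x, (θh (T - r ^ 2 / 2) x) ^ 2 with hBdef
  set W : ℝ := ∫ x, (θu (T - r ^ 2 / 2) x - θh (T - r ^ 2 / 2) x) ^ 2 with hWdef
  set X : ℝ := ∫ x, (θ₀ x) ^ 2 with hXdef
  have htb : T - r ^ 2 / 2 ∈ Set.Icc (T - r ^ 2) (T - r ^ 2 / 2) := ⟨hab.le, le_rfl⟩
  have hintu : Integrable (fun x => (θu (T - r ^ 2 / 2) x) ^ 2) := typeIFloor_integrable_sq_slice husm' hudec' htb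
  have hinth : Integrable (fun x => (θh (T - r ^ 2 / 2) x) ^ 2) := typeIFloor_integrable_sq_slice hhsm hhdec htb
  have hmemu : MemLp (θu (T - r ^ 2 / 2)) 2 volume := by
    refine (memLp_two_iff_integrable_sq ?_).2 hintu
    exact (husm'.continuous_slice htb).aestronglyMeasurable
  have hmemh : MemLp (θh (T - r ^ 2 / 2)) 2 volume := by
    refine (memLp_two_iff_integrable_sq ?_).2 hinth
    exact (hhsm.continuous_slice htb).aestronglyMeasurable
  have hA0 : 0 ≤ A := integral_nonneg fun _ => sq_nonneg _
  have hW0 : 0 ≤ W := integral_nonneg fun _ => sq_nonneg _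
  have hX0 : 0 ≤ X := integral_nonneg fun _ => sq_nonneg _
  -- Cauchy–Schwarz: `|∫ θu · w| ≤ √A √W`
  have hCS : |∫ x, θu (T - r ^ 2 / 2) x * (θu (T - r ^ 2 / 2) x - θh (T - r ^ 2 / 2) x)| ≤
      Real.sqrt A * Real.sqrt W := by
    have hmemw : MemLp (fun x => θu (T - r ^ 2 / 2) x - θh (T - r ^ 2 / 2) x) 2 volume := hmemu.sub hmemh
    have hfa : MemLp (fun x => |θu (T - r ^ 2 / 2) x|) 2 volume := hmemu.abs
    have hga : MemLp (fun x => |θu (T - r ^ 2 / 2) x - θh (T - r ^ 2 / 2) x|) 2 volume := hmemw.abs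
    have h := integral_mul_le_Lp_mul_Lq_of_nonneg (p := 2) (q := 2) (μ := volume)
      (f := fun x => |θu (T - r ^ 2 / 2) x|) (g := fun x => |θu (T - r ^ 2 / 2) x - θh (T - r ^ 2 / 2) x|)
      ⟨by norm_num, by norm_num, by norm_num⟩
      (Filter.Eventually.of_forall fun _ => abs_nonneg _) (Filter.Eventually.of_forall fun _ => abs_nonneg _)
      (by simpa using hfa) (by simpa using hga)
    have habs : |∫ x, θu (T - r ^ 2 / 2) x * (θu (T - r ^ 2 / 2) x - θh (T - r ^ 2 / 2) x)| ≤
        ∫ x, |θu (T - r ^ 2 / 2) x| * |θu (T - r ^ 2 / 2) x - θh (T - r ^ 2 / 2) x| := by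
      refine (abs_integral_le_integral_abs).trans (le_of_eq ?_)
      congr 1; funext x; exact abs_mul _ _
    refine habs.trans (h.trans (le_of_eq ?_))
    have e1 : (∫ x, |θu (T - r ^ 2 / 2) x| ^ (2 : ℝ)) = A := by
      rw [hAdef]; congr 1; funext x; rw [Real.rpow_two, sq_abs]
    have e2 : (∫ x, |θu (T - r ^ 2 / 2) x - θh (T - r ^ 2 / 2) x| ^ (2 : ℝ)) = W := by
      rw [hWdef]; congr 1; funext x; rw [Real.rpow_two, sq_abs]
    rw [e1, e2, Real.sqrt_eq_rpow, Real.sqrt_eq_rpow]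
  -- `Bh = A − 2∫θu w + W ≤ (√A + √W)²`
  have hBle : Bh ≤ (Real.sqrt A + Real.sqrt W) ^ 2 := by
    have hexp : Bh = A - 2 * (∫ x, θu (T - r ^ 2 / 2) x * (θu (T - r ^ 2 / 2) x - θh (T - r ^ 2 / 2) x)) + W := by
      have hint1 : Integrable (fun x => θu (T - r ^ 2 / 2) x * (θu (T - r ^ 2 / 2) x - θh (T - r ^ 2 / 2) x)) :=
        hmemu.integrable_mul (hmemu.sub hmemh)
      have hintW : Integrable (fun x => (θu (T - r ^ 2 / 2) x - θh (T - r ^ 2 / 2) x) ^ 2) :=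
        (memLp_two_iff_integrable_sq ((hmemu.sub hmemh).aestronglyMeasurable)).1 (hmemu.sub hmemh)
      have hpt : (fun x => (θh (T - r ^ 2 / 2) x) ^ 2) = fun x =>
          ((θu (T - r ^ 2 / 2) x) ^ 2 - 2 * (θu (T - r ^ 2 / 2) x * (θu (T - r ^ 2 / 2) x - θh (T - r ^ 2 / 2) x)))
            + (θu (T - r ^ 2 / 2) x - θh (T - r ^ 2 / 2) x) ^ 2 := by
        funext x; ring
      have h2 : Integrable (fun x => 2 * (θu (T - r ^ 2 / 2) x * (θu (T - r ^ 2 / 2) x - θh (T - r ^ 2 / 2) x))) :=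
        hint1.const_mul 2
      have hI1 : Integrable (fun x => (θu (T - r ^ 2 / 2) x) ^ 2 -
          2 * (θu (T - r ^ 2 / 2) x * (θu (T - r ^ 2 / 2) x - θh (T - r ^ 2 / 2) x))) := hintu.sub h2
      rw [hBdef, hpt, integral_add hI1 hintW, integral_sub hintu h2, integral_const_mul]
    rw [hexp]
    have hsA := Real.sq_sqrt hA0
    have hsW := Real.sq_sqrt hW0
    nlinarith [hCS, abs_le.1 hCS, Real.sqrt_nonneg A, Real.sqrt_nonneg W]
  -- numerics: `√W ≤ (c/2) √X`, `c √X < √Bh`, hence `(c/2) √X < √A`, so `A > (c/2)² X ≥ δ² X ≥ A`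
  have hWX : Real.sqrt W ≤ c / 2 * Real.sqrt X := by
    have h1 : W ≤ (c / 2) ^ 2 * ((r / 2) ^ 3 * V₁) := by
      have : c ^ 2 * V₁ / 64 * r * (r ^ 2 / 2) ≤ (c / 2) ^ 2 * ((r / 2) ^ 3 * V₁) := by nlinarith
      exact hWle.trans this
    have h2 : W ≤ (c / 2 * Real.sqrt X) ^ 2 := by
      rw [mul_pow, Real.sq_sqrt hX0]
      exact h1.trans (by nlinarith)
    calc Real.sqrt W ≤ Real.sqrt ((c / 2 * Real.sqrt X) ^ 2) := Real.sqrt_le_sqrt h2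
      _ = c / 2 * Real.sqrt X := Real.sqrt_sq (by positivity)
  have hXB : c * Real.sqrt X < Real.sqrt Bh := by
    have h1 : (c * Real.sqrt X) ^ 2 < Bh := by rw [mul_pow, Real.sq_sqrt hX0]; exact hB
    calc c * Real.sqrt X = Real.sqrt ((c * Real.sqrt X) ^ 2) := (Real.sqrt_sq (by positivity)).symm
      _ < Real.sqrt Bh := Real.sqrt_lt_sqrt (by positivity) h1
  have hBsq : Real.sqrt Bh ≤ Real.sqrt A + Real.sqrt W := by
    calc Real.sqrt Bh ≤ Real.sqrt ((Real.sqrt A + Real.sqrt W) ^ 2) := Real.sqrt_le_sqrt hBle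
      _ = Real.sqrt A + Real.sqrt W := Real.sqrt_sq (by positivity)
  have hAlow : c / 2 * Real.sqrt X < Real.sqrt A := by linarith
  have hAX : (c / 2) ^ 2 * X < A := by
    have h1 : (c / 2 * Real.sqrt X) ^ 2 < (Real.sqrt A) ^ 2 :=
      pow_lt_pow_left₀ hAlow (by positivity) two_ne_zero
    rwa [mul_pow, Real.sq_sqrt hX0, Real.sq_sqrt hA0] at h1
  have hδc : δ ^ 2 ≤ (c / 2) ^ 2 := pow_le_pow_left₀ hδ0 hδ2 2
  have : A ≤ (c / 2) ^ 2 * X := hA.trans (mul_le_mul_of_nonneg_right hδc hX0)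
  linarith

end Summit.NavierStokesRegularity.NavierStokesRegularity.Theorems

end
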